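import Summits.ValiantsHypothesis.ValiantsHypothesis.Theorems.LacunarySymmetroidMatrixDescartesKernelDefiniteJunctionAdditive
import Summits.ValiantsHypothesis.ValiantsHypothesis.Theorems.LacunarySymmetroidMatrixDescartesKernelDefiniteJunctionSeamDatum
import Summits.ValiantsHypothesis.ValiantsHypothesis.Theorems.LacunarySymmetroidMatrixDescartesKernelDefiniteJunctionSeamKernel
import Summits.ValiantsHypothesis.ValiantsHypothesis.Theorems.LacunarySymmetroidMatrixDescartesCensusEdgeThreeNine
import Literature.Analysis.Convex.SpectralConeLift

/-!
# Kernel-definite junction — THE STUB `stub_kernelDefiniteJunction` of the line `junction_ceiling`, PROVED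

Crux `MatrixDescartes` (stmt-ValiantsHypothesis-18050), line `Cruxes/MatrixDescartes/Lines/junction_ceiling.lean`
(ideator val-idea-5 g2), its ONE stub `stub_kernelDefiniteJunction (m) : KernelDefiniteJunction m`.
`kernelDefiniteJunction m` below is the line's `KernelDefiniteJunction m` with the line's vocabulary
(`posD`, `posM`, `pencil`, `junction`) UNFOLDED (the line file lives under `Cruxes/` and carries the `sorry`, so it
cannot be imported; the two statements agree definitionally and the line closes its stub by
`exact kernelDefiniteJunction m`).

**Statement.**  `P = ∑ X^{d l} S l` (`K₁+1` symmetric letters, `d` strictly increasing), `Q = ∑ X^{e l} T l`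
(`K₂+1` letters), `T 0 = S last =: J`, far ends `S 0`, `T last` nonsingular, and the two seam neighbours (`S last'`,
`T 1`) anisotropic on `ker J`.  Then for all large `Λ` the junction pencil
`H_Λ = P + ∑_{l ≥ 1} Λ^{-(e l − e 0)} X^{d last + e l − e 0} T l` has at most
`Z•(det P) + Z•(det Q) + (m − rank J)` distinct positive roots (`Z•` = positive roots with multiplicity).

**Proof** (parts 1–8 of this series, all in `Theorems/LacunarySymmetroidMatrixDescartesKernelDefiniteJunction*.lean`).
`det H_Λ (x) = x^{m d 0} G(x, x/Λ)` for the fixed bivariate polynomial `G = det 𝓗`, so the count is a NEWTON POLYGON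
count for the one-parameter family `∑ F i j Λ^{-j} x^{i+j}`: three edges (the `P`-window `x ~ 1` with edge polynomial
`det P̃`, the SEAM `x ~ Λ^{w/(g+w)}` and the `Q`-window `x ~ Λ` with edge polynomial `det Q̃`) and three gaps.  Each
window contributes at most the number of roots of its edge polynomial WITH multiplicity (windowed Rolle under
coefficientwise convergence, part 1) and each gap contributes nothing (dominant vertex, parts 2–3); the abstract
count is `newton_chain_ceiling` (part 4).  The vertices and the bottom/right edges are identified in parts 5–6
(`F 0 0 = det S 0`, `det T last`, `det P̃`, `det Q̃`).  If `det J ≠ 0` the seam is a single vertex and the junction is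
ADDITIVE (part 7, `nonsingularJunctionAdditive`).  If `det J = 0`, diagonalise `J = U diag(λ) Uᵀ`; rescaling the rows
of `Uᵀ 𝓗(z^w, z^{-g} v) U` by `z^{-wã}` (`λ_i ≠ 0`) resp. `z^{-wã'}` (`λ_i = 0`) gives the limit
`det(D) · det(A' + v^w B')` with `A', B'` the compressions of `S last'`, `T 1` to `ker J` (part 8a); reading
coefficients off this limit (8b–8e) yields the seam constraint of the Newton chain, the two seam vertices
`det D · det A' ≠ 0`, `det D · det B' ≠ 0` (anisotropy ⇒ the compressions are nonsingular, 8d) and a seam edge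
polynomial with at most `c + 1` monomials, `c = #{λ = 0} = m − rank J`; by Descartes' bound with multiplicity
(tree `Census.countP_posRoots_lt_card_support`) the seam carries at most `c` roots.

Honest framing: a structural statement about ONE construction (scale-separated junctions of lacunary symmetric
pencils); it is NOT a law and says nothing about `MatrixDescartes`, `DoorA26`, Conjecture B or VP ≠ VNP, none of
which is proved here. [folklore] (Newton polygon / Puiseux count of a one-parameter family; Schur-complement-free
row scaling at a singular letter.)
-/

-- `Summit.ValiantsHypothesis.ValiantsHypothesis.…` is the tree's mandated single-conjunct layout (Sub = Summit).
set_option linter.dupNamespace false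
set_option autoImplicit false

namespace Summit.ValiantsHypothesis.ValiantsHypothesis.Theorems.LacunarySymmetroidMatrixDescartes.JunctionCeiling

open Polynomial Finset Matrix Filter
open scoped BigOperators

/-- **The singular seam** (`K₁, K₂ ≥ 1`, junction letter diagonalised): the kernel-definite junction bound.
[folklore] -/
theorem junction_count_kernelDefinite {m : ℕ} (K₁ K₂ : ℕ) (d : Fin (K₁ + 1 + 1) → ℕ)
    (S : Fin (K₁ + 1 + 1) → Matrix (Fin m) (Fin m) ℝ) (e : Fin (K₂ + 1 + 1) → ℕ) (T : Fin (K₂ + 1 + 1) → Matrix (Fin m) (Fin m) ℝ)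
    (hd : StrictMono d) (he : StrictMono e) (h0 : T 0 = S (Fin.last (K₁ + 1))) (hS0 : (S 0).det ≠ 0)
    (hTl : (T (Fin.last (K₂ + 1))).det ≠ 0) (U : Matrix (Fin m) (Fin m) ℝ) (lam : Fin m → ℝ) (hU : U * Uᵀ = 1)
    (hJ : S (Fin.last (K₁ + 1)) = U * diagonal lam * Uᵀ)
    (hA : ∀ v : Fin m → ℝ, v ≠ 0 → S (Fin.last (K₁ + 1)) *ᵥ v = 0 → v ⬝ᵥ (S (Fin.last K₁).castSucc *ᵥ v) ≠ 0)
    (hB : ∀ v : Fin m → ℝ, v ≠ 0 → S (Fin.last (K₁ + 1)) *ᵥ v = 0 → v ⬝ᵥ (T 1 *ᵥ v) ≠ 0) :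
    ∀ᶠ Λ : ℝ in atTop,
      ((∑ l : Fin (K₁ + 1 + 1) ⊕ Fin (K₂ + 1),
          (X : ℝ[X]) ^ (Sum.elim d (fun l : Fin (K₂ + 1) => d (Fin.last (K₁ + 1)) + (e l.succ - e 0)) l) •
            (Sum.elim S (fun l : Fin (K₂ + 1) => (Λ⁻¹) ^ (e l.succ - e 0) • T l.succ) l).map C).det.roots.toFinset.filter
          (fun t => 0 < t)).card ≤
        (∑ l, (X : ℝ[X]) ^ d l • (S l).map C).det.roots.countP (fun t => 0 < t) +
          (∑ l, (X : ℝ[X]) ^ e l • (T l).map C).det.roots.countP (fun t => 0 < t) +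
          Fintype.card {i : Fin m // lam i = 0} := by
  classical
  set H : Matrix (Fin m) (Fin m) (Polynomial ℝ[X]) := Matrix.of fun i k =>
    (∑ l : Fin (K₁ + 1 + 1), C (C (S l i k)) * X ^ (d l - d 0)) +
      ∑ l : Fin (K₂ + 1), C (C (T l.succ i k) * X ^ (e l.succ - e 0)) * X ^ (d (Fin.last (K₁ + 1)) - d 0) with hHdef
  have hH : ∀ i k, H i k = (∑ l : Fin (K₁ + 1 + 1), C (C (S l i k)) * X ^ (d l - d 0)) +
      ∑ l : Fin (K₂ + 1), C (C (T l.succ i k) * X ^ (e l.succ - e 0)) * X ^ (d (Fin.last (K₁ + 1)) - d 0) :=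
    fun i k => rfl
  set w : ℕ := e 1 - e 0 with hw
  set g : ℕ := d (Fin.last (K₁ + 1)) - d (Fin.last K₁).castSucc with hg
  set n₀ : ℕ := ∑ i, (if lam i = 0 then d (Fin.last K₁).castSucc - d 0 else d (Fin.last (K₁ + 1)) - d 0) with hn₀
  set I : ℕ := m * (d (Fin.last (K₁ + 1)) - d 0) with hI
  set J : ℕ := m * (e (Fin.last (K₂ + 1)) - e 0) with hJdef
  set c : ℕ := Fintype.card {i : Fin m // lam i = 0} with hc
  set D : ℝ := ∏ i' : {i : Fin m // ¬ lam i = 0}, lam i'.1 with hD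
  set A : Matrix (Fin m) (Fin m) ℝ := Uᵀ * S (Fin.last K₁).castSucc * U with hAdef
  set B : Matrix (Fin m) (Fin m) ℝ := Uᵀ * T 1 * U with hBdef
  set φ : ℝ[X] := det (Matrix.of fun i' k' : {i : Fin m // lam i = 0} => C (A i'.1 k'.1) + X * C (B i'.1 k'.1))
    with hφ
  have hlast : (Fin.last K₁).castSucc < Fin.last (K₁ + 1) := Fin.castSucc_lt_last _
  have hw0 : 0 < w := Nat.sub_pos_of_lt (he Fin.zero_lt_one)
  have hg0 : 0 < g := Nat.sub_pos_of_lt (hd hlast)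
  have hD0 : D ≠ 0 := prod_ne_zero_eigs lam
  have hdetA : det (Matrix.of fun i' k' : {i : Fin m // lam i = 0} => A i'.1 k'.1) ≠ 0 :=
    det_kernelCompression_ne_zero U lam _ hU hJ _ hA
  have hdetB : det (Matrix.of fun i' k' : {i : Fin m // lam i = 0} => B i'.1 k'.1) ≠ 0 :=
    det_kernelCompression_ne_zero U lam _ hU hJ _ hB
  have hn0c : n₀ + g * c = I := n0_add_gc K₁ d lam hd
  have hcm : c ≤ m := card_eq_zero_le lam
  have hwJ : w * c ≤ J := by
    have h1 : w ≤ e (Fin.last (K₂ + 1)) - e 0 :=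
      Nat.sub_le_sub_right (he.monotone (Fin.le_last _)) _
    calc w * c ≤ (e (Fin.last (K₂ + 1)) - e 0) * m := Nat.mul_le_mul h1 hcm
      _ = J := by rw [hJdef, mul_comm]
  -- the two seam vertices
  have hn00 : ((det H).coeff n₀).coeff 0 ≠ 0 := by
    rw [seam_coeff K₁ K₂ d S e T H hH U lam hd he hU hJ n₀ 0 (by omega) (Nat.zero_le _) (by ring)]
    rw [if_pos (dvd_zero _), Nat.zero_div, coeff_phi_zero]
    exact mul_ne_zero hdetA hD0
  have hI2 : ((det H).coeff I).coeff (w * c) ≠ 0 := by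
    rw [seam_coeff K₁ K₂ d S e T H hH U lam hd he hU hJ I (w * c) le_rfl hwJ
      (by rw [← hn0c]; ring)]
    rw [if_pos (dvd_mul_right _ _), Nat.mul_div_cancel_left _ hw0, hc, coeff_phi_top]
    exact mul_ne_zero hdetB hD0
  -- the seam edge polynomial and its fewnomial bound
  set E₂ : ℝ[X] := ∑ i ∈ range (I + 1), ∑ j ∈ range (J + 1),
    C (if w * i = w * n₀ + g * j then ((det H).coeff i).coeff j else 0) * X ^ (i + j) with hE₂
  have hE₂c : E₂.roots.countP (fun t => 0 < t) ≤ c := by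
    by_cases hE0 : E₂ = 0
    · rw [hE0, roots_zero]; simp
    · have h1 := Summit.ValiantsHypothesis.ValiantsHypothesis.Theorems.LacunarySymmetroidMatrixDescartes.Census.countP_posRoots_lt_card_support
        hE0
      have h2 := card_support_seamEdge_le K₁ K₂ d S e T H hH U lam hd he hU hJ
      rw [← hE₂] at h2
      omega
  -- the bridge
  have hbridge := junction_count_of_seam (K₁ + 1) (K₂ + 1) d S e T H hH hd he h0 hS0 hTl n₀ (w * c) g w hg0 hw0
    (by omega) hwJ (by rw [show I - n₀ = g * c by omega]; ring)
    (fun i j hij => seam_constraint K₁ K₂ d S e T H hH U lam hd he hU hJ i j hij) hn00 hI2 E₂ hE₂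
  refine hbridge.mono fun Λ hΛ => ?_
  omega

/-- **THE STUB `stub_kernelDefiniteJunction` — the line's `KernelDefiniteJunction m`, all `m`** (vocabulary unfolded;
the line closes its stub by `exact kernelDefiniteJunction m`).  See the module docstring for statement, proof and
honest framing (nothing here bears on `MatrixDescartes`, Conjecture B or VP ≠ VNP). [folklore] -/
theorem kernelDefiniteJunction (m : ℕ) :
    ∀ (K₁ K₂ : ℕ) (d : Fin (K₁ + 1) → ℕ) (S : Fin (K₁ + 1) → Matrix (Fin m) (Fin m) ℝ)
      (e : Fin (K₂ + 1) → ℕ) (T : Fin (K₂ + 1) → Matrix (Fin m) (Fin m) ℝ),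
      StrictMono d → StrictMono e → (∀ l, (S l).IsSymm) → (∀ l, (T l).IsSymm) →
      T 0 = S (Fin.last K₁) → (S 0).det ≠ 0 → (T (Fin.last K₂)).det ≠ 0 →
      (∀ v : Fin m → ℝ, v ≠ 0 → (S (Fin.last K₁)).mulVec v = 0 →
          (∀ l : Fin (K₁ + 1), l < Fin.last K₁ → (∀ l', l' < Fin.last K₁ → l' ≤ l) → v ⬝ᵥ (S l).mulVec v ≠ 0) ∧
          (∀ l : Fin (K₂ + 1), 0 < l → (∀ l', 0 < l' → l ≤ l') → v ⬝ᵥ (T l).mulVec v ≠ 0)) →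
      ∀ᶠ Λ : ℝ in atTop,
        ((∑ l : Fin (K₁ + 1) ⊕ Fin K₂,
            (X : ℝ[X]) ^ (Sum.elim d (fun l : Fin K₂ => d (Fin.last K₁) + (e l.succ - e 0)) l) •
              ((Sum.elim S (fun l : Fin K₂ => (Λ⁻¹) ^ (e l.succ - e 0) • T l.succ) l).map C)).det.roots.toFinset.filter
            (fun t => 0 < t)).card ≤
          (∑ l, (X : ℝ[X]) ^ d l • (S l).map C).det.roots.countP (fun t => 0 < t) +
            (∑ l, (X : ℝ[X]) ^ e l • (T l).map C).det.roots.countP (fun t => 0 < t) +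
            (m - (S (Fin.last K₁)).rank) := by
  intro K₁ K₂ d S e T hd he hS hT h0 hS0 hTl hker
  classical
  by_cases hJ : (S (Fin.last K₁)).det ≠ 0
  · have h := junction_additive_of_det_ne_zero K₁ K₂ d S e T
      (Matrix.of fun i k => (∑ l : Fin (K₁ + 1), C (C (S l i k)) * X ^ (d l - d 0)) +
        ∑ l : Fin K₂, C (C (T l.succ i k) * X ^ (e l.succ - e 0)) * X ^ (d (Fin.last K₁) - d 0))
      (fun i k => rfl) hd he h0 hS0 hJ hTl
    exact h.mono fun Λ hΛ => hΛ.trans (Nat.le_add_right _ _)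
  push Not at hJ
  -- the singular case forces `K₁, K₂ ≥ 1`
  cases K₁ with
  | zero =>
    exfalso
    exact hS0 (by simpa using hJ)
  | succ K₁ =>
  cases K₂ with
  | zero =>
    exfalso
    apply hTl
    rw [show (Fin.last 0 : Fin 1) = 0 from rfl, h0]
    exact hJ
  | succ K₂ =>
  -- diagonalise the junction letter
  have hHerm : (S (Fin.last (K₁ + 1))).IsHermitian := by
    unfold Matrix.IsHermitian
    rw [Matrix.conjTranspose_eq_transpose_of_trivial]
    exact hS _
  obtain ⟨U, hU, hJU⟩ := Literature.Analysis.Convex.exists_orthogonal_conj_diagonal hHerm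
  have hlast : (Fin.last K₁).castSucc < Fin.last (K₁ + 1) := Fin.castSucc_lt_last _
  have hA : ∀ v : Fin m → ℝ, v ≠ 0 → S (Fin.last (K₁ + 1)) *ᵥ v = 0 →
      v ⬝ᵥ (S (Fin.last K₁).castSucc *ᵥ v) ≠ 0 := by
    intro v hv hJv
    refine (hker v hv hJv).1 _ hlast fun l' hl' => ?_
    rw [Fin.le_def, Fin.val_castSucc, Fin.val_last]
    have := Fin.lt_def.1 hl'
    rw [Fin.val_last] at this
    omega
  have hB : ∀ v : Fin m → ℝ, v ≠ 0 → S (Fin.last (K₁ + 1)) *ᵥ v = 0 → v ⬝ᵥ (T 1 *ᵥ v) ≠ 0 := by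
    intro v hv hJv
    refine (hker v hv hJv).2 1 Fin.zero_lt_one fun l' hl' => ?_
    rw [Fin.le_def, Fin.val_one]
    have := Fin.lt_def.1 hl'
    rw [Fin.val_zero] at this
    omega
  have h := junction_count_kernelDefinite K₁ K₂ d S e T hd he h0 hS0 hTl U hHerm.eigenvalues hU hJU hA hB
  rw [← corank_eq_card_eq_zero U hHerm.eigenvalues _ hU hJU] at h
  exact h

end Summit.ValiantsHypothesis.ValiantsHypothesis.Theorems.LacunarySymmetroidMatrixDescartes.JunctionCeiling
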